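import Literature.Probability.RandomPlanarGeometry.SAWTriangularBrickWalks
import Literature.Probability.RandomPlanarGeometry.SAWBridges
import HarnessLib

/-!
# Bridges and half-space walks of the triangular lattice (brick coordinates):
# `b_m b_n ≤ b_{m+n}` and `c_n ≤ Σ_m h_{m+1} h_{n−m}`

Topic `Literature/Probability/RandomPlanarGeometry` (continues `SAWTriangularBrickWalks.lean`: the
vertex-function model `brickSaws n` of the `n`-step self-avoiding walks of `𝕋` in brick coordinates,
height = coordinate `0`). Source: N. Madras, G. Slade, *The Self-Avoiding Walk* (1993), Definition 1.2.4
and eq. (1.2.15) (bridges: "the concatenation of two bridges will always yield another bridge"),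
Definition 3.1.2 (half-space walks) and the proof of Theorem 3.1.1, first line of (3.1.7)
(`c_N ≤ Σ_m h_{N−m} h_{m+1}`: cut at the last minimum of the height), there for `ℤ^d`; the same
definitions and arguments for a graph with a unimodular height function are Grimmett–Li's
[cite: GrimmettLi2018Locality, §4 (bridges and half-space walks for a graph height function)]. The
PREDICATES are the tree's `Zd.IsBridge n ω` (`ω₀(0) < ω₀(i) ≤ ω₀(n)`), `Zd.IsHalfSpace n ω`
(`ω₀(0) < ω₀(i)`) and the graph-free constructions `Zd.concatWalk`, `Zd.lastMin`, `Zd.tailWalk` of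
`SAWBridges.lean`, applied to the brick model; only the membership statements are re-proved here
(the proofs are those of `SAWBridges.lean`, with the step `−e₁` of the head piece replaced by the brick
step `(−2, 0)`).

## Contents (namespace `Literature.Probability.RandomPlanarGeometry.SAW`)

* `brickBridges n`, `brickBridgeCount n = b_n(𝕋)`, `brickHalfSpaceWalks n`, `brickHalfSpaceCount n = h_n(𝕋)`
  (`b_n ≤ h_n ≤ c_n(𝕋)`, `1 ≤ b_n` by the straight walk `i ↦ (2i, 0)`);
* `concatWalk_mem_brickSaws`, **`brickBridgeCount_mul_le : b_m b_n ≤ b_{m+n}`**;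
* `brickTailWalk_mem`, `brickHeadWalk`, `brickHeadWalk_mem`,
  **`triSawCount_le_sum_brickHalfSpaceCount : c_n(𝕋) ≤ Σ_{m=0}^{n} h_{m+1} h_{n−m}`**.
-/

noncomputable section

open Finset Function Literature.Probability.LatticeModels Literature.Probability.Percolation SimpleGraph
open scoped BigOperators

namespace Literature.Probability.RandomPlanarGeometry.SAW

open Zd

/-! ### Bridges and half-space walks of `𝕋` -/

open Classical in
/-- The `n`-step **bridges** of `𝕋` from the origin (brick height `X = 2x₀ + x₁`:
`X(ω(0)) < X(ω(i)) ≤ X(ω(n))` for `1 ≤ i ≤ n`). [cite: MadrasSlade1993, Definition 1.2.4] -/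
def brickBridges (n : ℕ) : Finset (ℕ → Site 2) := (brickSaws n).filter (Zd.IsBridge n)

/-- `b_n(𝕋)`, the number of `n`-step bridges of `𝕋` from the origin (`b₀ = 1`).
[cite: MadrasSlade1993, Definition 1.2.4] -/
def brickBridgeCount (n : ℕ) : ℕ := #(brickBridges n)

open Classical in
/-- The `n`-step **half-space walks** of `𝕋` from the origin (`X(ω(0)) < X(ω(i))` for `1 ≤ i ≤ n`).
[cite: MadrasSlade1993, Definition 3.1.2] -/
def brickHalfSpaceWalks (n : ℕ) : Finset (ℕ → Site 2) := (brickSaws n).filter (Zd.IsHalfSpace n)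

/-- `h_n(𝕋)`, the number of `n`-step half-space walks of `𝕋` from the origin (`h₀ = 1`).
[cite: MadrasSlade1993, Definition 3.1.2] -/
def brickHalfSpaceCount (n : ℕ) : ℕ := #(brickHalfSpaceWalks n)

/-- Membership in `brickBridges`. [cite: MadrasSlade1993, Definition 1.2.4] -/
theorem mem_brickBridges {n : ℕ} {ω : ℕ → Site 2} :
    ω ∈ brickBridges n ↔ ω ∈ brickSaws n ∧ Zd.IsBridge n ω := by
  classical
  exact Finset.mem_filter

/-- Membership in `brickHalfSpaceWalks`. [cite: MadrasSlade1993, Definition 3.1.2] -/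
theorem mem_brickHalfSpaceWalks {n : ℕ} {ω : ℕ → Site 2} :
    ω ∈ brickHalfSpaceWalks n ↔ ω ∈ brickSaws n ∧ Zd.IsHalfSpace n ω := by
  classical
  exact Finset.mem_filter

/-- `b_n(𝕋) ≤ c_n(𝕋)`. [cite: MadrasSlade1993, §1.2] -/
theorem brickBridgeCount_le_triSawCount (n : ℕ) : brickBridgeCount n ≤ triSawCount n := by
  classical
  rw [brickBridgeCount, brickBridges, ← card_brickSaws]
  exact Finset.card_filter_le _ _

/-- Bridges are half-space walks. [cite: MadrasSlade1993, §3.1] -/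
theorem brickBridges_subset_brickHalfSpaceWalks (n : ℕ) : brickBridges n ⊆ brickHalfSpaceWalks n := by
  intro ω hω
  rw [mem_brickBridges] at hω
  exact mem_brickHalfSpaceWalks.2 ⟨hω.1, hω.2.isHalfSpace⟩

/-- `h_n(𝕋) ≤ c_n(𝕋)`. [cite: MadrasSlade1993, §3.1] -/
theorem brickHalfSpaceCount_le_triSawCount (n : ℕ) : brickHalfSpaceCount n ≤ triSawCount n := by
  classical
  rw [brickHalfSpaceCount, brickHalfSpaceWalks, ← card_brickSaws]
  exact Finset.card_filter_le _ _

/-- The straight walk `i ↦ (2 min(i,n), 0)` of `𝕋` (steps `(2, 0)`, i.e. `e₀` of `𝕋`).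
[cite: MadrasSlade1993, §1.2] -/
def brickStraightWalk (n : ℕ) : ℕ → Site 2 := fun i j => if j = 0 then 2 * ((min i n : ℕ) : ℤ) else 0

/-- Coordinates of the straight walk. [cite: MadrasSlade1993, §1.2] -/
@[simp] theorem brickStraightWalk_apply_zero (n i : ℕ) :
    brickStraightWalk n i 0 = 2 * ((min i n : ℕ) : ℤ) := rfl

/-- Coordinates of the straight walk. [cite: MadrasSlade1993, §1.2] -/
@[simp] theorem brickStraightWalk_apply_one (n i : ℕ) : brickStraightWalk n i 1 = 0 := rfl

/-- The straight walk is a self-avoiding walk of `𝕋`. [cite: MadrasSlade1993, §1.2] -/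
theorem brickStraightWalk_mem_brickSaws (n : ℕ) : brickStraightWalk n ∈ brickSaws n := by
  refine mem_brickSaws.2 ⟨?_, fun i hi => ?_, fun i hi => ?_, ?_⟩
  · funext j
    fin_cases j <;> simp
  · funext j
    fin_cases j <;> simp [min_eq_right hi]
  · rw [brickGraph_adj_iff, brickStraightWalk_apply_zero, brickStraightWalk_apply_zero,
      brickStraightWalk_apply_one, brickStraightWalk_apply_one, min_eq_left hi.le,
      min_eq_left (Nat.succ_le_of_lt hi)]
    omega
  · intro i hi j hj hij
    simp only [Set.mem_setOf_eq] at hi hj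
    have := congrFun hij 0
    rw [brickStraightWalk_apply_zero, brickStraightWalk_apply_zero, min_eq_left hi, min_eq_left hj] at this
    omega

/-- The straight walk is a bridge: `b_n(𝕋) ≥ 1`. [cite: MadrasSlade1993, §1.2] -/
theorem one_le_brickBridgeCount (n : ℕ) : 1 ≤ brickBridgeCount n := by
  refine Finset.card_pos.2 ⟨brickStraightWalk n,
    mem_brickBridges.2 ⟨brickStraightWalk_mem_brickSaws n, ?_⟩⟩
  intro i h1 h2
  rw [brickStraightWalk_apply_zero, brickStraightWalk_apply_zero, brickStraightWalk_apply_zero,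
    min_eq_left h2, min_self, Nat.zero_min]
  omega

/-! ### Concatenation: `b_m b_n ≤ b_{m+n}` (Madras–Slade (1.2.15)) -/

/-- The concatenation of two self-avoiding walks of `𝕋` whose pieces are separated is self-avoiding
(separation supplied as a hypothesis). [cite: MadrasSlade1993, §1.2] -/
theorem concatWalk_mem_brickSaws {m n : ℕ} {ω υ : ℕ → Site 2} (hω : ω ∈ brickSaws m)
    (hυ : υ ∈ brickSaws n) (hsep : ∀ i ≤ m, ∀ j, 1 ≤ j → j ≤ n → ω i ≠ ω m + υ j) :
    concatWalk m ω υ ∈ brickSaws (m + n) := by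
  obtain ⟨hω0, hωend, hωadj, hωinj⟩ := mem_brickSaws.1 hω
  obtain ⟨hυ0, hυend, hυadj, hυinj⟩ := mem_brickSaws.1 hυ
  refine mem_brickSaws.2 ⟨by simp [concatWalk, hω0], ?_, ?_, ?_⟩
  · intro i hi
    have h1 : ¬ i ≤ m ∨ n = 0 := by omega
    rcases h1 with h1 | rfl
    · have h2 : ¬ m + n ≤ m ∨ n = 0 := by omega
      rcases h2 with h2 | rfl
      · simp only [concatWalk, if_neg h1, if_neg h2, Nat.add_sub_cancel_left]
        rw [hυend (i - m) (by omega)]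
      · simp only [concatWalk, if_neg h1, add_zero, if_pos le_rfl]
        rw [hυend (i - m) (by omega), ← hυend 0 le_rfl, hυ0, add_zero]
    · simp only [add_zero] at hi ⊢
      simp only [concatWalk, if_pos le_rfl]
      by_cases h : i ≤ m
      · rw [if_pos h, hωend i hi]
      · rw [if_neg h, hυend (i - m) (by omega), ← hυend 0 le_rfl, hυ0, add_zero]
  · intro i hi
    by_cases h : i + 1 ≤ m
    · simp only [concatWalk, if_pos h, if_pos (Nat.le_of_succ_le h)]
      exact hωadj i h
    · by_cases h' : i ≤ m
      · have him : i = m := by omega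
        subst him
        simp only [concatWalk, if_pos le_rfl, if_neg h, Nat.add_sub_cancel_left]
        have := (brickGraph_adj_add_right (υ 0) (υ 1) (ω i)).2 (hυadj 0 (by omega))
        rwa [hυ0, zero_add, add_comm] at this
      · simp only [concatWalk, if_neg h, if_neg h']
        rw [show i + 1 - m = (i - m) + 1 by omega, add_comm (ω m) (υ (i - m)),
          add_comm (ω m), brickGraph_adj_add_right]
        exact hυadj (i - m) (by omega)
  · intro i hi j hj hij
    simp only [Set.mem_setOf_eq] at hi hj
    simp only [concatWalk] at hij
    by_cases h1 : i ≤ m <;> by_cases h2 : j ≤ m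
    · rw [if_pos h1, if_pos h2] at hij
      exact hωinj (show i ≤ m from h1) (show j ≤ m from h2) hij
    · rw [if_pos h1, if_neg h2] at hij
      exact absurd hij (hsep i h1 (j - m) (by omega) (by omega))
    · rw [if_neg h1, if_pos h2] at hij
      exact absurd hij.symm (hsep j h2 (i - m) (by omega) (by omega))
    · rw [if_neg h1, if_neg h2, add_right_inj] at hij
      have := hυinj (show i - m ≤ n by omega) (show j - m ≤ n by omega) hij
      omega

/-- **`b_m(𝕋) · b_n(𝕋) ≤ b_{m+n}(𝕋)`**: the concatenation of two bridges is a bridge.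
[cite: MadrasSlade1993, §1.2, eq. (1.2.15)] -/
theorem brickBridgeCount_mul_le (m n : ℕ) :
    brickBridgeCount m * brickBridgeCount n ≤ brickBridgeCount (m + n) := by
  rw [brickBridgeCount, brickBridgeCount, brickBridgeCount, ← Finset.card_product]
  refine Finset.card_le_card_of_injOn (fun p => concatWalk m p.1 p.2) ?_ ?_
  · rintro ⟨ω, υ⟩ hp
    simp only [Finset.mem_coe, Finset.mem_product, mem_brickBridges] at hp
    obtain ⟨⟨hω, hωb⟩, hυ, hυb⟩ := hp
    show concatWalk m ω υ ∈ (brickBridges (m + n) : Set (ℕ → Site 2))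
    rw [Finset.mem_coe, mem_brickBridges]
    have hω0 := (mem_brickSaws.1 hω).1
    have hυ0 := (mem_brickSaws.1 hυ).1
    have h00 : (0 : Site 2) 0 = 0 := rfl
    have hle : ∀ i ≤ m, ω i 0 ≤ ω m 0 := by
      intro i hi
      rcases Nat.eq_zero_or_pos i with rfl | hpos
      · rcases Nat.eq_zero_or_pos m with rfl | hm
        · exact le_rfl
        · exact (hωb m hm le_rfl).1.le
      · exact (hωb i hpos hi).2
    have hm0 : 0 ≤ ω m 0 := by have := hle 0 (Nat.zero_le m); rwa [hω0] at this
    have hυn : 0 ≤ υ n 0 := by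
      rcases Nat.eq_zero_or_pos n with rfl | hn
      · rw [hυ0, h00]
      · have := (hυb n hn le_rfl).1
        rw [hυ0, h00] at this
        exact this.le
    have hgt : ∀ j, 1 ≤ j → j ≤ n → ω m 0 < (ω m + υ j) 0 := by
      intro j h1 h2
      have := (hυb j h1 h2).1
      rw [hυ0, h00] at this
      simp only [Pi.add_apply]
      linarith
    refine ⟨concatWalk_mem_brickSaws hω hυ fun i hi j h1 h2 heq => ?_, ?_⟩
    · have ha := hle i hi
      have hb := hgt j h1 h2
      rw [← heq] at hb
      linarith
    · intro i h1 h2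
      have hstart : concatWalk m ω υ 0 = 0 := by simp [concatWalk, hω0]
      have hlast : concatWalk m ω υ (m + n) 0 = ω m 0 + υ n 0 := by
        by_cases h : m + n ≤ m
        · have hn : n = 0 := by omega
          subst hn
          simp [concatWalk, hυ0]
        · simp [concatWalk, h]
      rw [hstart, hlast, h00]
      by_cases h : i ≤ m
      · simp only [concatWalk, if_pos h]
        have := (hωb i h1 h).1
        rw [hω0, h00] at this
        exact ⟨this, (hle i h).trans (by linarith)⟩
      · simp only [concatWalk, if_neg h, Pi.add_apply]
        have := hυb (i - m) (by omega) (by omega)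
        rw [hυ0, h00] at this
        exact ⟨by linarith [this.1], by linarith [this.2]⟩
  · rintro ⟨ω, υ⟩ hp ⟨ω', υ'⟩ hp' h
    simp only [Finset.mem_coe, Finset.mem_product, mem_brickBridges] at hp hp'
    dsimp only at h
    have hω := mem_brickSaws.1 hp.1.1
    have hυ := mem_brickSaws.1 hp.2.1
    have hω' := mem_brickSaws.1 hp'.1.1
    have hυ' := mem_brickSaws.1 hp'.2.1
    have h1 : ω = ω' := by
      funext i
      rcases le_or_gt i m with hi | hi
      · have := congrFun h i
        simpa [concatWalk, hi] using this
      · rw [hω.2.1 i hi.le, hω'.2.1 i hi.le]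
        have := congrFun h m
        simpa [concatWalk] using this
    subst h1
    simp only [Prod.mk.injEq, true_and]
    funext j
    rcases Nat.eq_zero_or_pos j with rfl | hj
    · rw [hυ.1, hυ'.1]
    · have := congrFun h (m + j)
      simpa [concatWalk, Nat.not_le.2 (by omega : m < m + j)] using this

/-! ### Cutting at the last minimum of the height: `c_n(𝕋) ≤ Σ_{m=0}^{n} h_{m+1} h_{n−m}` -/

/-- The tail piece (after the last minimum of the height, translated to `0`) is a half-space walk
of `𝕋`. [cite: MadrasSlade1993, §3.1, proof of Theorem 3.1.1] -/
theorem brickTailWalk_mem {n : ℕ} {ω : ℕ → Site 2} (hω : ω ∈ brickSaws n) :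
    tailWalk n ω ∈ brickHalfSpaceWalks (n - lastMin n ω) := by
  obtain ⟨h0, hend, hadj, hinj⟩ := mem_brickSaws.1 hω
  obtain ⟨m, hm⟩ : ∃ m, lastMin n ω = m := ⟨_, rfl⟩
  have hmn : m ≤ n := hm ▸ lastMin_le n ω
  have hlt : ∀ i, m < i → i ≤ n → ω m 0 < ω i 0 := fun i h1 h2 => by
    subst hm
    exact apply_lastMin_lt h1 h2
  rw [hm]
  refine mem_brickHalfSpaceWalks.2 ⟨mem_brickSaws.2 ⟨?_, ?_, ?_, ?_⟩, ?_⟩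
  · rw [tailWalk_apply hm]
    simp
  · intro i hi
    rw [tailWalk_apply hm, tailWalk_apply hm, min_eq_right hi, min_self]
  · intro i hi
    rw [tailWalk_apply hm, tailWalk_apply hm, min_eq_left hi.le,
      min_eq_left (by omega : i + 1 ≤ n - m), brickGraph_adj_sub_right, ← add_assoc]
    exact hadj (m + i) (by omega)
  · intro i hi j hj hij
    simp only [Set.mem_setOf_eq] at hi hj
    rw [tailWalk_apply hm, tailWalk_apply hm, min_eq_left hi, min_eq_left hj, sub_left_inj] at hij
    have := hinj (by simp only [Set.mem_setOf_eq]; omega)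
      (by simp only [Set.mem_setOf_eq]; omega) hij
    omega
  · intro i h1 h2
    rw [tailWalk_apply hm, tailWalk_apply hm, Nat.zero_min, add_zero, sub_self, min_eq_left h2,
      Pi.sub_apply, Pi.zero_apply, sub_pos]
    exact hlt (m + i) (by omega) (by omega)

/-- The part of `ω` up to the last minimum `m` of the height, reversed, preceded by one brick step
`(−2, 0)` (the step `−e₀` of `𝕋`, which lowers the height below the minimum and is therefore
fresh) and translated to start at `0`: an `(m+1)`-step half-space walk.
[cite: MadrasSlade1993, §3.1, proof of Theorem 3.1.1] -/
def brickHeadWalk (n : ℕ) (ω : ℕ → Site 2) : ℕ → Site 2 :=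
  fun i => if i = 0 then 0 else
    ω (lastMin n ω + 1 - min i (lastMin n ω + 1)) - ω (lastMin n ω) + Pi.single 0 2

/-- Values of `brickHeadWalk`. [cite: MadrasSlade1993, §3.1] -/
theorem brickHeadWalk_apply {n m : ℕ} {ω : ℕ → Site 2} (hm : lastMin n ω = m) (i : ℕ) :
    brickHeadWalk n ω i =
      if i = 0 then 0 else ω (m + 1 - min i (m + 1)) - ω m + Pi.single 0 2 := by
  simp only [brickHeadWalk, hm]

/-- The head piece is a half-space walk of `𝕋`. [cite: MadrasSlade1993, §3.1, proof of Theorem 3.1.1] -/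
theorem brickHeadWalk_mem {n : ℕ} {ω : ℕ → Site 2} (hω : ω ∈ brickSaws n) :
    brickHeadWalk n ω ∈ brickHalfSpaceWalks (lastMin n ω + 1) := by
  obtain ⟨h0, hend, hadj, hinj⟩ := mem_brickSaws.1 hω
  obtain ⟨m, hm⟩ : ∃ m, lastMin n ω = m := ⟨_, rfl⟩
  have hmn : m ≤ n := hm ▸ lastMin_le n ω
  have hle : ∀ i ≤ n, ω m 0 ≤ ω i 0 := fun i hi => by
    subst hm
    exact apply_lastMin_le hi
  rw [hm]
  have hpos : ∀ i, 1 ≤ i → 2 ≤ brickHeadWalk n ω i 0 := by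
    intro i hi
    rw [brickHeadWalk_apply hm, if_neg (by omega)]
    simp only [Pi.add_apply, Pi.sub_apply, Pi.single_eq_same]
    have := hle (m + 1 - min i (m + 1)) (by omega)
    linarith
  have hz : brickHeadWalk n ω 0 = 0 := by rw [brickHeadWalk_apply hm, if_pos rfl]
  refine mem_brickHalfSpaceWalks.2 ⟨mem_brickSaws.2 ⟨hz, ?_, ?_, ?_⟩, ?_⟩
  · intro i hi
    rw [brickHeadWalk_apply hm, brickHeadWalk_apply hm, if_neg (by omega), if_neg (by omega),
      min_eq_right hi, min_self]
  · intro i hi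
    rcases Nat.eq_zero_or_pos i with rfl | hipos
    · rw [hz, brickHeadWalk_apply hm, if_neg (by omega), zero_add,
        min_eq_left (by omega : 1 ≤ m + 1), Nat.add_sub_cancel, sub_self, zero_add,
        brickGraph_adj_iff]
      simp
    · rw [brickHeadWalk_apply hm, brickHeadWalk_apply hm, if_neg (by omega), if_neg (by omega),
        min_eq_left (by omega : i ≤ m + 1), min_eq_left (by omega : i + 1 ≤ m + 1),
        brickGraph_adj_add_right, brickGraph_adj_sub_right,
        show m + 1 - i = (m + 1 - (i + 1)) + 1 by omega]
      exact (hadj (m + 1 - (i + 1)) (by omega)).symm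
  · intro i hi j hj hij
    simp only [Set.mem_setOf_eq] at hi hj
    rcases Nat.eq_zero_or_pos i with rfl | hipos <;> rcases Nat.eq_zero_or_pos j with rfl | hjpos
    · rfl
    · exfalso
      have h1 := hpos j hjpos
      rw [← hij, hz] at h1
      simp at h1
    · exfalso
      have h1 := hpos i hipos
      rw [hij, hz] at h1
      simp at h1
    · rw [brickHeadWalk_apply hm, brickHeadWalk_apply hm, if_neg (by omega), if_neg (by omega),
        min_eq_left (by omega : i ≤ m + 1), min_eq_left (by omega : j ≤ m + 1),
        add_left_inj, sub_left_inj] at hij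
      have := hinj (by simp only [Set.mem_setOf_eq]; omega)
        (by simp only [Set.mem_setOf_eq]; omega) hij
      omega
  · intro i h1 h2
    have := hpos i h1
    rw [hz, Pi.zero_apply]
    linarith

/-- **`c_n(𝕋) ≤ Σ_{m=0}^{n} h_{m+1}(𝕋) · h_{n−m}(𝕋)`**: cut an `n`-step self-avoiding walk at the last
minimum `m` of its height; the piece after `m` is a half-space walk, and the piece up to `m`, reversed
and preceded by the step `−e₀`, is a half-space walk; `ω` is recovered from the two pieces and `m`.
[cite: MadrasSlade1993, §3.1, eq. (3.1.7)] -/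
theorem triSawCount_le_sum_brickHalfSpaceCount (n : ℕ) :
    triSawCount n ≤
      ∑ m ∈ Finset.range (n + 1), brickHalfSpaceCount (m + 1) * brickHalfSpaceCount (n - m) := by
  classical
  have hcard : ((Finset.range (n + 1)).sigma
      fun m => brickHalfSpaceWalks (m + 1) ×ˢ brickHalfSpaceWalks (n - m)).card =
      ∑ m ∈ Finset.range (n + 1), brickHalfSpaceCount (m + 1) * brickHalfSpaceCount (n - m) := by
    rw [Finset.card_sigma]
    simp_rw [Finset.card_product]
    rfl
  rw [← card_brickSaws, ← hcard]
  refine Finset.card_le_card_of_injOn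
    (fun ω => (⟨lastMin n ω, (brickHeadWalk n ω, tailWalk n ω)⟩ :
      Σ _ : ℕ, (ℕ → Site 2) × (ℕ → Site 2))) ?_ ?_
  · intro ω hω
    rw [Finset.mem_coe] at hω
    rw [Finset.mem_coe, Finset.mem_sigma, Finset.mem_range, Finset.mem_product]
    exact ⟨Nat.lt_succ_of_le (lastMin_le n ω), brickHeadWalk_mem hω, brickTailWalk_mem hω⟩
  · intro ω hω ω' hω' h
    rw [Finset.mem_coe] at hω hω'
    simp only [Sigma.mk.inj_iff] at h
    obtain ⟨hmm, h⟩ := h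
    have h' : (brickHeadWalk n ω, tailWalk n ω) = (brickHeadWalk n ω', tailWalk n ω') := eq_of_heq h
    simp only [Prod.mk.injEq] at h'
    obtain ⟨hh, ht⟩ := h'
    obtain ⟨h0, hend, hadj, hinj⟩ := mem_brickSaws.1 hω
    obtain ⟨h0', hend', hadj', hinj'⟩ := mem_brickSaws.1 hω'
    obtain ⟨m, hm⟩ : ∃ m, lastMin n ω = m := ⟨_, rfl⟩
    have hm' : lastMin n ω' = m := hmm.symm.trans hm
    have hmn : m ≤ n := hm ▸ lastMin_le n ω
    -- recover `ω m` from the last vertex of the head piece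
    have hωm : ω m = ω' m := by
      have := congrFun hh (m + 1)
      rw [brickHeadWalk_apply hm, brickHeadWalk_apply hm', if_neg (by omega), if_neg (by omega), min_self,
        Nat.sub_self, h0, h0', add_left_inj, zero_sub, zero_sub, neg_inj] at this
      exact this
    funext i
    rcases le_or_gt i m with hi | hi
    · rcases Nat.eq_zero_or_pos (m - i) with h | h
      · have : i = m := by omega
        rw [this, hωm]
      · have := congrFun hh (m + 1 - i)
        rw [brickHeadWalk_apply hm, brickHeadWalk_apply hm', if_neg (by omega), if_neg (by omega),
          min_eq_left (by omega : m + 1 - i ≤ m + 1), show m + 1 - (m + 1 - i) = i by omega,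
          hωm, add_left_inj, sub_left_inj] at this
        exact this
    · rcases le_or_gt i n with hin | hin
      · have := congrFun ht (i - m)
        rw [tailWalk_apply hm, tailWalk_apply hm', min_eq_left (by omega : i - m ≤ n - m),
          show m + (i - m) = i by omega, hωm, sub_left_inj] at this
        exact this
      · have := congrFun ht (n - m)
        rw [tailWalk_apply hm, tailWalk_apply hm', min_self, show m + (n - m) = n by omega, hωm,
          sub_left_inj] at this
        rw [hend i hin.le, hend' i hin.le, this]

end Literature.Probability.RandomPlanarGeometry.SAW
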